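import Summits.NavierStokesRegularity.NavierStokesRegularity.Theorems.CriticalSwirlRegularity.Negative.HardnessSandwich

/-!
# Route FlatSwirlGauge — gauge elimination: the auxiliary fields `(b, d)` of the v0 block are syntactic sugar

Negative-side (dossier) support file for the crux `CriticalSwirlRegularity` (CSR, item
`stmt-NavierStokesRegularity-1253`, route `FlatSwirlGauge` of NavierStokesRegularity), written by the line lead
(continuation c8) of the dead line `registered`. The v0 gauge block inlined in the three cruxes of the route
(`FlatGaugeAtSingularity`, `CriticalSwirlRegularity`, `FlatGaugeExcludesTypeI`; packaged verbatim as
`Literature.Analysis.FluidPDE.IsFlatSwirlGaugeOn` / `HasFlatSwirlGauge`) carries SIX data fields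
`(ρ, C₀, M, α, b, d)`: the momentum `α`, a drift `b` and a "degeneracy gauge" `d`, coupled through three pointwise
clauses required only where `d > 0` and one volume clause on the sub-level sets of `d`. This file proves that the
two auxiliary fields carry no information:

* `exists_isFlatSwirlGaugeOn_iff` (**gauge elimination**, same constants). For `ν > 0` and fixed
  `(ρ, C₀, M, α)`, SOME `(b, d)` completes the data to a flat swirl gauge iff
  `0 < ρ`, `ρ² < T`, `0 ≤ C₀`, `α ∈ C²(Q_ρ)`, `|α| ≤ M` and `⟪curl u, ∇α⟫ = 0` on `Q_ρ`, and the single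
  **weak-L² nondegeneracy clause**
  `vol({x ∈ B_ρ(x₀) | C₀‖∇α‖ < δ‖curl u‖ ∨ C₀ν‖∇α‖ < δ|𝒟α|}) ≤ C₀ δ² ρ` for `t ∈ (T − ρ², T)`, `0 < δ < ρ`,
  where `𝒟α := ∂ₜα + (u·∇)α − νΔα` is the heat-transport DEFECT of `α`. In words: the hypothesis of the crux is
  exactly "`α` is a bounded `C²` first integral of the vorticity on a backward cylinder whose nondegeneracy ratio
  `max(‖ω‖, |𝒟α|/ν)/‖∇α‖` is uniformly weak-`L²` with the axis-like profile `C₀δ²ρ`". The optimal auxiliary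
  fields are `b = (𝒟α/(ν‖∇α‖²)) ∇α` and `d = min(C₀‖∇α‖/‖ω‖, C₀ν‖∇α‖/|𝒟α|)` (value `ρ` for a vanishing
  denominator); conversely any admissible `(b, d)` has `{ratio > C₀/δ} ⊆ {d < δ}`.
* `hasFlatSwirlGauge_iff_firstIntegral`: hence `HasFlatSwirlGauge ν u T x₀` is a statement about FOUR data
  `(ρ, C₀, M, α)`, and
* `criticalSwirlRegularity_iff_firstIntegral`: the crux, restated definitionally-equivalently WITHOUT `b, d`
  (a checked restatement the planner may adopt for 1252/1253/1254, whose gauge blocks are byte-identical).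
* `volume_gradient_eq_zero_inter_eq_zero`: a consequence recorded for the dossiers — at each admissible time the
  set of points of `B_ρ(x₀)` where `∇α = 0` but `curl u ≠ 0` is Lebesgue-null (it lies in every sub-level set of
  the clause), i.e. a flat swirl gauge is nondegenerate a.e. on the support of the vorticity.

Reading for the restatement menu (dossiers `Cruxes/CriticalSwirlRegularity/Lines/registered-dead*.md`): the only
quantitative knob of the object is the profile `δ ↦ C₀δ²ρ` of the nondegeneracy clause (line-like degeneracy,
`1/r ∈ L^{2,∞}`); the exponent `2` is what admits the axisymmetric anchor `α = Γ` (`ratio ≲ 1/r`) and, with it,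
the open localized axisymmetric problem (`HardnessSandwich.lean`); the rest-state witnesses of c1–c3 are the case
`curl u ≡ 0`, where the clause constrains only the heat defect `𝒟α` of an otherwise arbitrary bounded `α`.
Nothing here is new mathematics (pointwise algebra and monotonicity of Lebesgue measure).

## References

* G. Koch, N. Nadirashvili, G. Seregin, V. Šverák, *Liouville theorems for the Navier–Stokes equations and
  applications*, Acta Math. 203 (2009) 83–105, eq. (1.8) (the exactly-flat model `α = Γ`). [KNSS2009]
-/

noncomputable section

namespace Summit.NavierStokesRegularity.NavierStokesRegularity.Theorems.CriticalSwirlRegularity.Negative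

open Literature.Analysis.FluidPDE Set Metric MeasureTheory Function Filter
open scoped Topology

variable {ν T ρ C₀ M : ℝ} {u : ℝ → EuclideanSpace ℝ (Fin 3) → EuclideanSpace ℝ (Fin 3)}
  {x₀ : EuclideanSpace ℝ (Fin 3)} {α : ℝ → EuclideanSpace ℝ (Fin 3) → ℝ}

/-- **Gauge elimination, forward direction.** If `(α, b, d)` is a flat swirl gauge on `Q_ρ(T, x₀)` with
constants `(C₀, M)` and `ν ≥ 0`, then at every admissible time and for every `δ > 0` the super-level set of the
nondegeneracy ratio, `{C₀‖∇α‖ < δ‖curl u‖} ∪ {C₀ν‖∇α‖ < δ|∂ₜα + (u·∇)α − νΔα|}`, is contained in `{d < δ}`: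
where `d ≥ δ > 0` the clauses `‖curl u‖ d ≤ C₀‖∇α‖`, `‖b‖ d ≤ C₀` and `∂ₜα + (u·∇)α − νΔα = ν⟪b, ∇α⟫` forbid
both inequalities. [folklore] -/
theorem setOf_ratio_subset_setOf_lt {b : ℝ → EuclideanSpace ℝ (Fin 3) → EuclideanSpace ℝ (Fin 3)}
    {d : ℝ → EuclideanSpace ℝ (Fin 3) → ℝ} (hν : 0 ≤ ν)
    (h : IsFlatSwirlGaugeOn ν u T x₀ ρ C₀ M α b d) {t : ℝ} (ht : t ∈ Ioo (T - ρ ^ 2) T) {δ : ℝ}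
    (hδ : 0 < δ) :
    {x | C₀ * ‖gradient (α t) x‖ < δ * ‖curl (u t) x‖ ∨
        C₀ * ν * ‖gradient (α t) x‖ <
          δ * |deriv (fun s => α s x) t + convect (u t) (α t) x - ν * Laplacian.laplacian (α t) x|} ∩
        ball x₀ ρ ⊆ {x | d t x < δ} ∩ ball x₀ ρ := by
  rintro x ⟨hx, hxB⟩
  refine ⟨?_, hxB⟩
  by_contra hdx
  simp only [mem_setOf_eq, not_lt] at hdx
  have hdpos : 0 < d t x := hδ.trans_le hdx
  obtain ⟨-, -, hcl⟩ := h.2.2.2.2 t ht x hxB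
  obtain ⟨h4, h5, h6⟩ := hcl hdpos
  rcases hx with hx | hx
  · -- `C₀‖∇α‖ < δ‖ω‖ ≤ d‖ω‖ ≤ C₀‖∇α‖`
    have : δ * ‖curl (u t) x‖ ≤ ‖curl (u t) x‖ * d t x := by
      rw [mul_comm]
      exact mul_le_mul_of_nonneg_left hdx (norm_nonneg _)
    linarith
  · -- the defect is `ν⟪b, ∇α⟫`, of size `≤ ν‖b‖‖∇α‖ ≤ ν C₀ ‖∇α‖ / d`
    have hD : deriv (fun s => α s x) t + convect (u t) (α t) x - ν * Laplacian.laplacian (α t) x =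
        ν * inner ℝ (b t x) (gradient (α t) x) := by
      rw [h6]; ring
    rw [hD] at hx
    have h1 : |ν * inner ℝ (b t x) (gradient (α t) x)| ≤ ν * (‖b t x‖ * ‖gradient (α t) x‖) := by
      rw [abs_mul, abs_of_nonneg hν]
      exact mul_le_mul_of_nonneg_left (abs_real_inner_le_norm (b t x) (gradient (α t) x)) hν
    have h2 : δ * |ν * inner ℝ (b t x) (gradient (α t) x)| ≤
        d t x * (ν * (‖b t x‖ * ‖gradient (α t) x‖)) :=
      mul_le_mul hdx h1 (abs_nonneg _) hdpos.le
    have h3 : d t x * (ν * (‖b t x‖ * ‖gradient (α t) x‖)) ≤ C₀ * ν * ‖gradient (α t) x‖ := by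
      have : d t x * (ν * (‖b t x‖ * ‖gradient (α t) x‖)) =
          (‖b t x‖ * d t x) * (ν * ‖gradient (α t) x‖) := by ring
      rw [this]
      calc ‖b t x‖ * d t x * (ν * ‖gradient (α t) x‖) ≤ C₀ * (ν * ‖gradient (α t) x‖) :=
            mul_le_mul_of_nonneg_right h5 (mul_nonneg hν (norm_nonneg (gradient (α t) x)))
        _ = C₀ * ν * ‖gradient (α t) x‖ := by ring
    linarith

/-- **Gauge elimination** (`(b, d)` are syntactic sugar; same constants). For `ν > 0` and fixed
`(ρ, C₀, M, α)`, some drift `b` and degeneracy gauge `d` complete the data to a flat swirl gauge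
`IsFlatSwirlGaugeOn ν u T x₀ ρ C₀ M α b d` if and only if: `0 < ρ`, `ρ² < T`, `0 ≤ C₀`, `α ∈ C²(Q_ρ(T, x₀))`,
on the cylinder `|α| ≤ M` and `⟪curl u, ∇α⟫ = 0` (first integral of the vorticity), and the weak-`L²`
NONDEGENERACY CLAUSE: for `t ∈ (T − ρ², T)` and `0 < δ < ρ`,
`vol({x ∈ B_ρ(x₀) | C₀‖∇α‖ < δ‖curl u‖ ∨ C₀ν‖∇α‖ < δ|∂ₜα + (u·∇)α − νΔα|}) ≤ C₀ δ² ρ`.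
Forward: `setOf_ratio_subset_setOf_lt` and `IsFlatSwirlGaugeOn.const_nonneg`. Backward: take
`b := (𝒟α/(ν‖∇α‖²)) ∇α` (`𝒟α` the heat-transport defect) and
`d := min (C₀‖∇α‖/‖curl u‖) (C₀ν‖∇α‖/|𝒟α|)` with the value `ρ` for a vanishing denominator; then
`‖curl u‖ d ≤ C₀‖∇α‖`, `‖b‖ d ≤ C₀`, the transport law holds where `d > 0` (there `∇α = 0` forces `𝒟α = 0`),
and `{d < δ}` is exactly the displayed set for `δ < ρ`. [folklore] -/
theorem exists_isFlatSwirlGaugeOn_iff (hν : 0 < ν) :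
    (∃ (b : ℝ → EuclideanSpace ℝ (Fin 3) → EuclideanSpace ℝ (Fin 3)) (d : ℝ → EuclideanSpace ℝ (Fin 3) → ℝ),
        IsFlatSwirlGaugeOn ν u T x₀ ρ C₀ M α b d) ↔
      0 < ρ ∧ ρ ^ 2 < T ∧ 0 ≤ C₀ ∧
        ContDiffOn ℝ 2 (uncurry α) (Ioo (T - ρ ^ 2) T ×ˢ ball x₀ ρ) ∧
        (∀ t ∈ Ioo (T - ρ ^ 2) T, ∀ x ∈ ball x₀ ρ,
          |α t x| ≤ M ∧ inner ℝ (curl (u t) x) (gradient (α t) x) = 0) ∧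
        (∀ t ∈ Ioo (T - ρ ^ 2) T, ∀ δ ∈ Ioo 0 ρ,
          volume ({x | C₀ * ‖gradient (α t) x‖ < δ * ‖curl (u t) x‖ ∨
              C₀ * ν * ‖gradient (α t) x‖ <
                δ * |deriv (fun s => α s x) t + convect (u t) (α t) x -
                  ν * Laplacian.laplacian (α t) x|} ∩ ball x₀ ρ) ≤
            ENNReal.ofReal (C₀ * δ ^ 2 * ρ)) := by
  constructor
  · rintro ⟨b, d, h⟩
    refine ⟨h.1, h.2.1, h.const_nonneg, h.2.2.1, fun t ht x hx => ?_, fun t ht δ hδ => ?_⟩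
    · obtain ⟨h1, h2, -⟩ := h.2.2.2.2 t ht x hx
      exact ⟨h1, h2⟩
    · exact (measure_mono (setOf_ratio_subset_setOf_lt hν.le h ht hδ.1)).trans (h.2.2.2.1 t ht δ hδ)
  · rintro ⟨hρ, hρT, hC, hcd, hpt, hvol⟩
    classical
    -- the heat-transport defect, the optimal drift and the optimal degeneracy gauge
    set D : ℝ → EuclideanSpace ℝ (Fin 3) → ℝ := fun t x =>
      deriv (fun s => α s x) t + convect (u t) (α t) x - ν * Laplacian.laplacian (α t) x with hDdef
    let b : ℝ → EuclideanSpace ℝ (Fin 3) → EuclideanSpace ℝ (Fin 3) := fun t x =>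
      (D t x / (ν * ‖gradient (α t) x‖ ^ 2)) • gradient (α t) x
    let A : ℝ → EuclideanSpace ℝ (Fin 3) → ℝ := fun t x =>
      if curl (u t) x = 0 then ρ else C₀ * ‖gradient (α t) x‖ / ‖curl (u t) x‖
    let B : ℝ → EuclideanSpace ℝ (Fin 3) → ℝ := fun t x =>
      if D t x = 0 then ρ else C₀ * ν * ‖gradient (α t) x‖ / |D t x|
    refine ⟨b, fun t x => min (A t x) (B t x), hρ, hρT, hcd, fun t ht δ hδ => ?_, fun t ht x hx => ?_⟩
    · -- `{min A B < δ} ∩ B_ρ ⊆` the displayed set, for `δ < ρ`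
      refine (measure_mono ?_).trans (hvol t ht δ hδ)
      rintro x ⟨hx, hxB⟩
      refine ⟨?_, hxB⟩
      simp only [mem_setOf_eq] at hx ⊢
      rcases min_lt_iff.1 hx with hA | hB
      · left
        by_cases hω : curl (u t) x = 0
        · exact absurd (by simpa [A, hω] using hA) (not_lt.2 hδ.2.le)
        · have hωpos : 0 < ‖curl (u t) x‖ := norm_pos_iff.2 hω
          have hA' : C₀ * ‖gradient (α t) x‖ / ‖curl (u t) x‖ < δ := by simpa [A, hω] using hA
          rwa [div_lt_iff₀ hωpos] at hA'
      · right
        by_cases hD0 : D t x = 0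
        · exact absurd (by simpa [B, hD0] using hB) (not_lt.2 hδ.2.le)
        · have hDpos : 0 < |D t x| := abs_pos.2 hD0
          have hB' : C₀ * ν * ‖gradient (α t) x‖ / |D t x| < δ := by simpa [B, hD0] using hB
          rwa [div_lt_iff₀ hDpos] at hB'
    · obtain ⟨h1, h2⟩ := hpt t ht x hx
      refine ⟨h1, h2, fun hd => ?_⟩
      have hApos : 0 < A t x := lt_min_iff.1 hd |>.1
      have hBpos : 0 < B t x := lt_min_iff.1 hd |>.2
      have hdA : min (A t x) (B t x) ≤ A t x := min_le_left _ _
      have hdB : min (A t x) (B t x) ≤ B t x := min_le_right _ _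
      refine ⟨?_, ?_, ?_⟩
      · -- `‖ω‖ d ≤ ‖ω‖ A = C₀‖∇α‖`
        by_cases hω : curl (u t) x = 0
        · rw [hω, norm_zero, zero_mul]; positivity
        · have hωpos : 0 < ‖curl (u t) x‖ := norm_pos_iff.2 hω
          calc ‖curl (u t) x‖ * min (A t x) (B t x) ≤ ‖curl (u t) x‖ * A t x :=
                mul_le_mul_of_nonneg_left hdA hωpos.le
            _ = C₀ * ‖gradient (α t) x‖ := by
                simp only [A, hω, if_false]
                field_simp
      · -- `‖b‖ d ≤ ‖b‖ B = C₀`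
        by_cases hD0 : D t x = 0
        · have hb0 : b t x = 0 := by simp [b, hD0]
          rw [hb0, norm_zero, zero_mul]; exact hC
        · by_cases hg : gradient (α t) x = 0
          · have hb0 : b t x = 0 := by simp [b, hg]
            rw [hb0, norm_zero, zero_mul]; exact hC
          · have hgpos : 0 < ‖gradient (α t) x‖ := norm_pos_iff.2 hg
            have hDpos : 0 < |D t x| := abs_pos.2 hD0
            have hnb : ‖b t x‖ = |D t x| / (ν * ‖gradient (α t) x‖) := by
              simp only [b, norm_smul, Real.norm_eq_abs, abs_div, abs_mul, abs_of_pos hν, abs_pow,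
                abs_norm]
              field_simp
            calc ‖b t x‖ * min (A t x) (B t x) ≤ ‖b t x‖ * B t x :=
                  mul_le_mul_of_nonneg_left hdB (norm_nonneg _)
              _ = C₀ := by
                  rw [hnb]
                  simp only [B, hD0, if_false]
                  field_simp
      · -- the transport law: `ν(Δα + ⟪b, ∇α⟫) = νΔα + 𝒟α`
        by_cases hg : gradient (α t) x = 0
        · -- a vanishing gradient with `d > 0` forces `𝒟α = 0`
          have hD0 : D t x = 0 := by
            by_contra hD0
            have : B t x = 0 := by simp [B, hD0, hg]
            exact hBpos.ne' this
          have hb0 : b t x = 0 := by simp [b, hg]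
          rw [hb0, inner_zero_left, add_zero]
          have := hD0
          simp only [hDdef] at this
          linarith
        · have hgpos : 0 < ‖gradient (α t) x‖ := norm_pos_iff.2 hg
          have hinner : inner ℝ (b t x) (gradient (α t) x) = D t x / ν := by
            simp only [b, real_inner_smul_left, real_inner_self_eq_norm_sq]
            field_simp
          rw [hinner, mul_add, mul_div_cancel₀ _ hν.ne']
          simp only [hDdef]
          ring

/-- **`HasFlatSwirlGauge` is a statement about four data `(ρ, C₀, M, α)`**: for `ν > 0`, `u` admits a flat
swirl gauge at `(T, x₀)` iff on some backward cylinder `Q_ρ(T, x₀)` there is a bounded `C²` first integral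
`α` of the vorticity (`|α| ≤ M`, `⟪curl u, ∇α⟫ = 0`) with `0 ≤ C₀` and the weak-`L²` nondegeneracy clause
`vol({x ∈ B_ρ(x₀) | C₀‖∇α‖ < δ‖curl u‖ ∨ C₀ν‖∇α‖ < δ|∂ₜα + (u·∇)α − νΔα|}) ≤ C₀δ²ρ` (`t ∈ (T − ρ², T)`,
`0 < δ < ρ`). Immediate from `exists_isFlatSwirlGaugeOn_iff`. [folklore] -/
theorem hasFlatSwirlGauge_iff_firstIntegral (hν : 0 < ν) :
    HasFlatSwirlGauge ν u T x₀ ↔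
      ∃ (ρ C₀ M : ℝ) (α : ℝ → EuclideanSpace ℝ (Fin 3) → ℝ),
        0 < ρ ∧ ρ ^ 2 < T ∧ 0 ≤ C₀ ∧
        ContDiffOn ℝ 2 (uncurry α) (Ioo (T - ρ ^ 2) T ×ˢ ball x₀ ρ) ∧
        (∀ t ∈ Ioo (T - ρ ^ 2) T, ∀ x ∈ ball x₀ ρ,
          |α t x| ≤ M ∧ inner ℝ (curl (u t) x) (gradient (α t) x) = 0) ∧
        (∀ t ∈ Ioo (T - ρ ^ 2) T, ∀ δ ∈ Ioo 0 ρ,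
          volume ({x | C₀ * ‖gradient (α t) x‖ < δ * ‖curl (u t) x‖ ∨
              C₀ * ν * ‖gradient (α t) x‖ <
                δ * |deriv (fun s => α s x) t + convect (u t) (α t) x -
                  ν * Laplacian.laplacian (α t) x|} ∩ ball x₀ ρ) ≤
            ENNReal.ofReal (C₀ * δ ^ 2 * ρ)) := by
  constructor
  · rintro ⟨ρ, C₀, M, α, b, d, h⟩
    exact ⟨ρ, C₀, M, α, (exists_isFlatSwirlGaugeOn_iff hν).1 ⟨b, d, h⟩⟩
  · rintro ⟨ρ, C₀, M, α, h⟩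
    obtain ⟨b, d, hg⟩ := (exists_isFlatSwirlGaugeOn_iff hν).2 h
    exact ⟨ρ, C₀, M, α, b, d, hg⟩

/-- **The crux `CriticalSwirlRegularity` without the auxiliary fields** (checked restatement, equivalent to the
route decl): a classical Leray–Hopf solution on `[0, T)` from a rapidly decaying datum which carries, on some
backward cylinder `Q_ρ(T, x₀)`, a bounded `C²` first integral `α` of its vorticity with the weak-`L²`
nondegeneracy clause of `hasFlatSwirlGauge_iff_firstIntegral`, is bounded on some `(T − r², T) × B_r(x₀)`.
Proof: `criticalSwirlRegularity_iff_hasFlatSwirlGauge` (`Iff.rfl`) and `hasFlatSwirlGauge_iff_firstIntegral`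
under the binder `0 < ν`. [folklore] -/
theorem criticalSwirlRegularity_iff_firstIntegral :
    Summit.NavierStokesRegularity.NavierStokesRegularity.Theses.FlatSwirlGauge.CriticalSwirlRegularity ↔
      ∀ (ν T : ℝ), 0 < ν → 0 < T →
        ∀ (u : ℝ → EuclideanSpace ℝ (Fin 3) → EuclideanSpace ℝ (Fin 3))
          (p : ℝ → EuclideanSpace ℝ (Fin 3) → ℝ),
          IsClassicalNSSolutionOn (Set.Ico 0 T) ν 0 u p → IsLerayHopfOn T ν 0 (u 0) u →
            HasRapidSpatialDecay (u 0) → ∀ x₀ : EuclideanSpace ℝ (Fin 3),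
              (∃ (ρ C₀ M : ℝ) (α : ℝ → EuclideanSpace ℝ (Fin 3) → ℝ),
                0 < ρ ∧ ρ ^ 2 < T ∧ 0 ≤ C₀ ∧
                ContDiffOn ℝ 2 (uncurry α) (Ioo (T - ρ ^ 2) T ×ˢ ball x₀ ρ) ∧
                (∀ t ∈ Ioo (T - ρ ^ 2) T, ∀ x ∈ ball x₀ ρ,
                  |α t x| ≤ M ∧ inner ℝ (curl (u t) x) (gradient (α t) x) = 0) ∧
                (∀ t ∈ Ioo (T - ρ ^ 2) T, ∀ δ ∈ Ioo 0 ρ,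
                  volume ({x | C₀ * ‖gradient (α t) x‖ < δ * ‖curl (u t) x‖ ∨
                      C₀ * ν * ‖gradient (α t) x‖ <
                        δ * |deriv (fun s => α s x) t + convect (u t) (α t) x -
                          ν * Laplacian.laplacian (α t) x|} ∩ ball x₀ ρ) ≤
                    ENNReal.ofReal (C₀ * δ ^ 2 * ρ))) →
                ∃ r : ℝ, 0 < r ∧ ∃ K : ℝ, ∀ t ∈ Set.Ioo (T - r ^ 2) T, 0 ≤ t →
                  ∀ x ∈ Metric.ball x₀ r, ‖u t x‖ ≤ K := by
  rw [criticalSwirlRegularity_iff_hasFlatSwirlGauge]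
  refine forall₂_congr fun ν T => forall_congr' fun hν => forall_congr' fun _ =>
    forall₂_congr fun u p => forall₃_congr fun _ _ _ => forall_congr' fun x₀ => ?_
  rw [hasFlatSwirlGauge_iff_firstIntegral hν]

/-- **A flat swirl gauge is nondegenerate a.e. on the support of the vorticity.** If `(α, b, d)` is a flat
swirl gauge on `Q_ρ(T, x₀)` (any `ν ≥ 0`), then at every admissible time the set of points of `B_ρ(x₀)` where
`∇α = 0` but `curl u ≠ 0` is Lebesgue-null: it lies in `{C₀‖∇α‖ < δ‖curl u‖}` for every `δ > 0`, whose trace on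
the ball has volume `≤ C₀δ²ρ → 0` (`setOf_ratio_subset_setOf_lt`). (The chart-nondegeneracy clause alone gives
this only off `{d ≤ 0}`; the volume clause makes `{d ≤ 0}` null.) [folklore] -/
theorem volume_gradient_eq_zero_inter_eq_zero
    {b : ℝ → EuclideanSpace ℝ (Fin 3) → EuclideanSpace ℝ (Fin 3)} {d : ℝ → EuclideanSpace ℝ (Fin 3) → ℝ}
    (hν : 0 ≤ ν) (h : IsFlatSwirlGaugeOn ν u T x₀ ρ C₀ M α b d) {t : ℝ} (ht : t ∈ Ioo (T - ρ ^ 2) T) :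
    volume ({x | gradient (α t) x = 0 ∧ curl (u t) x ≠ 0} ∩ ball x₀ ρ) = 0 := by
  have hρ := h.radius_pos
  have hC := h.const_nonneg
  -- volume `≤ C₀ δ² ρ` for every `0 < δ < ρ`
  have hle : ∀ δ ∈ Ioo 0 ρ, volume ({x | gradient (α t) x = 0 ∧ curl (u t) x ≠ 0} ∩ ball x₀ ρ) ≤
      ENNReal.ofReal (C₀ * δ ^ 2 * ρ) := by
    intro δ hδ
    refine (measure_mono ?_).trans
      ((measure_mono (setOf_ratio_subset_setOf_lt hν h ht hδ.1)).trans (h.2.2.2.1 t ht δ hδ))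
    rintro x ⟨⟨hg, hω⟩, hxB⟩
    refine ⟨Or.inl ?_, hxB⟩
    rw [hg, norm_zero, mul_zero]
    exact mul_pos hδ.1 (norm_pos_iff.2 hω)
  -- let `δ = ρ/(n+2) → 0`
  refine le_antisymm ?_ bot_le
  have hlim : Tendsto (fun n : ℕ => ENNReal.ofReal (C₀ * (ρ / (n + 2)) ^ 2 * ρ)) atTop (𝓝 0) := by
    rw [← ENNReal.ofReal_zero]
    refine ENNReal.tendsto_ofReal ?_
    have h1 : Tendsto (fun n : ℕ => ρ / ((n : ℝ) + 2)) atTop (𝓝 0) := by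
      have : Tendsto (fun n : ℕ => (n : ℝ) + 2) atTop atTop :=
        tendsto_natCast_atTop_atTop.atTop_add tendsto_const_nhds
      exact this.const_div_atTop ρ |>.congr fun n => rfl
    have h2 : Tendsto (fun n : ℕ => C₀ * (ρ / ((n : ℝ) + 2)) ^ 2 * ρ) atTop (𝓝 (C₀ * 0 ^ 2 * ρ)) :=
      ((h1.pow 2).const_mul C₀).mul_const ρ
    simpa using h2
  refine ge_of_tendsto hlim (Eventually.of_forall fun n => hle _ ⟨by positivity, ?_⟩)
  rw [div_lt_iff₀ (by positivity)]
  nlinarith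

end Summit.NavierStokesRegularity.NavierStokesRegularity.Theorems.CriticalSwirlRegularity.Negative

end
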